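import Literature.IUT.HodgeTheaters.InitialThetaDataCurveModelLocal
import Literature.AnabelianGeometry.AbsoluteAnabelian.NumberFieldValuationProSetDecomposition
import Literature.NumberTheory.Automorphic.AdicCompletionLocalField
import Literature.NumberTheory.GaloisRepresentations.PadicAlgebraOfLocalField
import Mathlib.Topology.Algebra.Module.FiniteDimension
import HarnessLib

/-!
# [IUTchI] Def. 3.1 (e): laws of the enriched model `InitialThetaData.nfCurveModelLocal` — the input classes of
# [AbsTopIII] Thm. 1.9 / Cor. 1.10 are DISCHARGED at the local curves `C_v`, `X_v`

S. Mochizuki, *Inter-universal Teichmüller theory I*, §3, Definition 3.1 (e) (kurims final manuscript, May 2020,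
pp. 62–63) [claim: Mochizuki2012, status: disputed]; [AbsTopIII] Thm. 1.9 p. 37 ("a hyperbolic orbicurve of
strictly Belyi type over a sub-`p`-adic field"), Cor. 1.10 p. 41 ("a hyperbolic orbicurve over an MLF")
[MochizukiAbsTopIII2015] (RIMS-preprint pagination; in the journal version, J. Math. Sci. Univ. Tokyo **22** (2015),
these are pp. 986 / 992 — journal page = PDF page + 938; locator concordance recorded after the RQ7 notes).  abc-iut
cell, GAP B item GB-13, PROOF companion of `InitialThetaDataCurveModelLocal.lean` (the model `D.nfCurveModelLocal G` =
GB-07's four global curves with NF-points ⊕ the local curves over `K_v := v.adicCompletion K`), for data in ANY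
universe `Type u` (first landing: `Type` only, because the tree's `isMLF_adicCompletion` is stated for `F : Type`;
gen-2 rider: the universe-polymorphic `isMLF_adicCompletion_univ` below, and the section's binders generalised in place
`{F K Fbar : Type} ↦ {F K Fbar : Type u}` — names and statements otherwise unchanged — so the consumers GB-14/GB-18/GB-19/
GB-20, which bind `{F K Fbar : Type u}`, meet the input classes BY NAME and need not carry them as `hin` binders)

* `isMLF_adicCompletion_univ` — **for a number field `K : Type u` and a finite place `v`, `K_v` is an MLF**: `v` lies
  over a rational prime `ℓ`, `|ℓ|_v < 1`, the canonical continuous `ℚ_ℓ → K_v` (`LocalField.padicRingHom`) makes the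
  locally compact Hausdorff field `K_v` a topological `ℚ_ℓ`-vector space, finite-dimensional by Riesz's theorem
  (Mathlib `FiniteDimensional.of_locallyCompactSpace`, topological-vector-space form) — Serre, *Local Fields* II §5,
  Neukirch II (5.2), Weil BNT III §1;
* `isMLF_localBase`, `isSubpadic_localBase` — `K_v` is an MLF, hence sub-`p`-adic (`IsSubpadic.of_isMLF`);
* `isCor110Input_localCurveModel` / `isCor110Input_local` — EVERY local curve is an input of Cor. 1.10, so the
  binder `(h₁₁₀ : Cor_1_10_iii (D.nfCurveModelLocal G))` speaks about all of them;
* `isThm19Input_localCurveModel` / `isThm19Input_local` / `isThm19Input_nfCurveModelLocal` — every curve of the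
  enriched model (global: GB-07's `isThm19Input_nfCurveModelOfPoints`; local: strictly Belyi type FILLED BY PRINT
  as in GB-07, sub-`p`-adic REAL) is an input of Thm. 1.9, so `(h₁₉ : Thm_1_9 (D.nfCurveModelLocal G))` speaks
  about all eight families of curves.

Theorems only (no definitions, no instances, no notation); nothing of the disputed series is asserted; no side
is taken on [IUTchIII] Cor. 3.12.
-/

noncomputable section

namespace Literature.IUT.HodgeTheaters

open CategoryTheory NumberField IsDedekindDomain
open Literature.AnabelianGeometry.AbsoluteAnabelian
open Literature.AnabelianGeometry.AbsoluteAnabelian.AbsTopIII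
open Literature.NumberTheory.GaloisRepresentations

universe u

/-! ### `K_v` is an MLF, any universe -/

section AdicCompletion

variable {K : Type u} [Field K] [NumberField K]

/-- **The completion `K_v` of a number field `K : Type u` at a finite place `v` is an MLF** ("a finite field
extension of `ℚ_p` for some `p`", [AbsTopI] §0 p. 7): `v` lies over a rational prime `ℓ` (the characteristic of the
finite residue field `𝓞 K ⧸ 𝔭_v`; Neukirch I §8), `|ℓ|_v < 1` (`LocalField.valuation_adicCompletion_natCast_lt_one`), and
the canonical continuous embedding `ℚ_ℓ → K_v` (`LocalField.padicRingHom`, Serre II §5) makes the locally compact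
Hausdorff field `K_v` (tree instance `instIsNonarchimedeanLocalFieldAdicCompletion`) a topological `ℚ_ℓ`-vector space,
which is finite-dimensional by Riesz's theorem (Mathlib `FiniteDimensional.of_locallyCompactSpace`).  Universe-polymorphic
form of the tree's `isMLF_adicCompletion` (`F : Type`), whose finiteness step `PadicBase.instFiniteDimensional` lives at
`Type`. [cite: NeukirchANT1999, Ch. II (5.2)] -/
theorem isMLF_adicCompletion_univ (v : HeightOneSpectrum (𝓞 K)) :
    Literature.AnabelianGeometry.AbsoluteAnabelian.IsMLF (v.adicCompletion K) := by
  -- the rational prime under `v` (adapted from the universe-`0` `exists_prime_natCast_mem_asIdeal`)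
  obtain ⟨ℓ, hℓ, hv⟩ : ∃ ℓ : ℕ, ℓ.Prime ∧ ((ℓ : ℕ) : 𝓞 K) ∈ v.asIdeal := by
    haveI : v.asIdeal.IsPrime := v.isPrime
    haveI : Finite (𝓞 K ⧸ v.asIdeal) := Ideal.finiteQuotientOfFreeOfNeBot v.asIdeal v.ne_bot
    obtain ⟨q, hq⟩ := CharP.exists (𝓞 K ⧸ v.asIdeal)
    have hqprime : q.Prime := (CharP.char_is_prime_or_zero (𝓞 K ⧸ v.asIdeal) q).resolve_right
      (CharP.char_ne_zero_of_finite (𝓞 K ⧸ v.asIdeal) q)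
    refine ⟨q, hqprime, ?_⟩
    rw [← Ideal.Quotient.eq_zero_iff_mem, map_natCast]
    exact CharP.cast_eq_zero _ q
  haveI : Fact ℓ.Prime := ⟨hℓ⟩
  haveI : CharZero (v.adicCompletion K) := LocalField.charZero_adicCompletion v
  have hlt : ValuativeRel.valuation (v.adicCompletion K) (ℓ : v.adicCompletion K) < 1 :=
    LocalField.valuation_adicCompletion_natCast_lt_one v ℓ hv
  -- the canonical `ℚ_ℓ → K_v` and the topological `ℚ_ℓ`-vector space structure it induces
  let f : ℚ_[ℓ] →+* v.adicCompletion K := LocalField.padicRingHom (v.adicCompletion K) ℓ hlt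
  have hf : Continuous f := LocalField.continuous_padicRingHom (v.adicCompletion K) ℓ hlt
  letI : Algebra ℚ_[ℓ] (v.adicCompletion K) := f.toAlgebra
  haveI : ContinuousSMul ℚ_[ℓ] (v.adicCompletion K) := by
    refine ⟨?_⟩
    have hmul : (fun q : ℚ_[ℓ] × v.adicCompletion K => q.1 • q.2) = fun q => f q.1 * q.2 := by
      funext q
      exact Algebra.smul_def q.1 q.2
    rw [hmul]
    exact (hf.comp continuous_fst).mul continuous_snd
  -- Riesz: a locally compact Hausdorff topological vector space over the complete field `ℚ_ℓ` is finite-dimensional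
  haveI : FiniteDimensional ℚ_[ℓ] (v.adicCompletion K) := FiniteDimensional.of_locallyCompactSpace ℚ_[ℓ]
  exact ⟨ℓ, inferInstance, f, ‹FiniteDimensional ℚ_[ℓ] (v.adicCompletion K)›⟩

end AdicCompletion

namespace InitialThetaData

namespace LocalThetaGeometry

section Laws

variable {F K Fbar : Type u} [Field F] [NumberField F] [Field K] [NumberField K] [Algebra F K]
  [Field Fbar] [Algebra F Fbar] [Algebra K Fbar] {E : WeierstrassCurve F} [E.IsElliptic] {l : ℕ}
  {Pb : BadPlacePredicates K} {D : InitialThetaData F K Fbar E l Pb} (G : D.LocalThetaGeometry)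

/-- **The base field `K_v` of every local curve is an MLF** ([AbsTopI] §0: a finite extension of some `ℚ_p`;
`isMLF_adicCompletion_univ`, any universe). [claim: Mochizuki2012, status: disputed] -/
theorem isMLF_localBase (U : G.localCurveModel.Curve) :
    Literature.AnabelianGeometry.AbsoluteAnabelian.IsMLF (G.localCurveModel.base U) :=
  isMLF_adicCompletion_univ _

/-- The base field `K_v` of every local curve is sub-`p`-adic (`IsSubpadic.of_isMLF`).
[claim: Mochizuki2012, status: disputed] -/
theorem isSubpadic_localBase (U : G.localCurveModel.Curve) : IsSubpadic (G.localCurveModel.base U) :=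
  IsSubpadic.of_isMLF (G.isMLF_localBase U)

/-- **Every local curve is an input of [AbsTopIII] Cor. 1.10** ("a hyperbolic orbicurve over an MLF").
[claim: Mochizuki2012, status: disputed] -/
theorem isCor110Input_localCurveModel (U : G.localCurveModel.Curve) : G.localCurveModel.IsCor110Input U :=
  G.isMLF_localBase U

/-- **Every local curve is an input of [AbsTopIII] Thm. 1.9**: strictly Belyi type (FILLED BY PRINT, as for
the global curves: [AbsTopIII] Rmk. 2.8.3 with Def. 3.1 (d)) over a sub-`p`-adic field (REAL: `K_v` is an MLF).
[claim: Mochizuki2012, status: disputed] -/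
theorem isThm19Input_localCurveModel (U : G.localCurveModel.Curve) : G.localCurveModel.IsThm19Input U :=
  ⟨trivial, G.isSubpadic_localBase U⟩

/-- Every local curve of the enriched model `D.nfCurveModelLocal G` is an input of Cor. 1.10.
[claim: Mochizuki2012, status: disputed] -/
theorem isCor110Input_local (i : LocalNFCurveIndex K) : (D.nfCurveModelLocal G).IsCor110Input (D.locCurve G i) :=
  (CurveModel.sum_isCor110Input_inr (D.nfCurveModelOfPoints G.nfPointData) G.localCurveModel (ULift.up i)).2
    (G.isCor110Input_localCurveModel (ULift.up i))

/-- Every local curve of the enriched model is an input of Thm. 1.9. [claim: Mochizuki2012, status: disputed] -/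
theorem isThm19Input_local (i : LocalNFCurveIndex K) : (D.nfCurveModelLocal G).IsThm19Input (D.locCurve G i) :=
  (CurveModel.sum_isThm19Input_inr (D.nfCurveModelOfPoints G.nfPointData) G.localCurveModel (ULift.up i)).2
    (G.isThm19Input_localCurveModel (ULift.up i))

/-- **Every curve of the enriched model — `C_F, X_F, C_K, X_K` and all `C_v, X_v` — is an input of [AbsTopIII]
Thm. 1.9**, so the binder `Thm_1_9 (D.nfCurveModelLocal G)` constrains the algorithm at every one of them.
[claim: Mochizuki2012, status: disputed] -/
theorem isThm19Input_nfCurveModelLocal (U : (D.nfCurveModelLocal G).Curve) : (D.nfCurveModelLocal G).IsThm19Input U := by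
  obtain ⟨⟨i⟩⟩ | ⟨⟨i⟩⟩ := U
  · exact D.isThm19Input_global G i
  · exact G.isThm19Input_local i

/-- The base field of a local curve of the enriched model is an MLF. [claim: Mochizuki2012, status: disputed] -/
theorem isMLF_base_local (i : LocalNFCurveIndex K) :
    Literature.AnabelianGeometry.AbsoluteAnabelian.IsMLF ((D.nfCurveModelLocal G).base (D.locCurve G i)) :=
  isMLF_adicCompletion_univ _

end Laws

end LocalThetaGeometry

end InitialThetaData

end Literature.IUT.HodgeTheaters

end
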